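import Mathlib
import Summits.PneNP.PneNP.Theorems.KrwChromaticSteeringStrongCompositionLradState

/-!
# p4 g22 — the RETIREMENT move and the retired floor (crux `StrongComposition`, stmt-PneNP-18538)

Companion to `Cruxes/StrongComposition/LensBarrierP4g22.md`.  FRONTIER bookkeeping for the restricted-class ladder
LRAD ⊂ LRB ⊂ LRX_t ⊂ LRA of the KRW strong-composition crux C1; nothing here bears on P vs NP.

* §1 `retire_two` (PROVED): in ANY hard label rectangle `A × B` and for ANY coordinate `j`, the adversary may kill the
  coordinate on BOTH sides — restrict to `a_j = b_j = v` for a suitable `v` — at a cost of at most TWO units of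
  Karchmer–Wigderson hardness (`Hard.split_bob` then `Hard.split_alice` of the landed `KrwLrad` rectangle lemmas; the
  mixed quadrant `a_j ≠ b_j` is solved by the leaf `j`, so the aligned quadrant is the hard one).  Unlike the forced-half
  lemma (`P4g21X.forcedHalf_alice`, cost 1, which needs `b_j` constant on `B`) it has NO side condition: this is the move
  that lets the adversary CASH an over-loaded row («retirement», memo §5) — the repair of the (BANK) books.
* §2 `RetiredFloorGe` : the «2-retired floor» `M* ≥ x` of a family of row credits (there is a set `S` of rows, not all of
  them, such that every other row has credit `≥ x + 2|S|`), with the two one-step facts the potential `Φ* = h + M* − Π*`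
  uses at non-kill events: credits dropping by `≤ 1` lower `M*` by `≤ 1` (`RetiredFloorGe.of_drop_le_one`), and `M*` is
  antitone in `x` (`RetiredFloorGe.mono`).
-/

set_option linter.dupNamespace false
set_option autoImplicit false

namespace Summit.PneNP.PneNP.Cruxes.StrongComposition.P4g22X

open Literature.Computability.Complexity
open Summit.PneNP.PneNP.Theorems.KrwLrad

universe u

variable {ι : Type u}

/-! ## §1 Retirement costs at most two -/
section Retire

/-- **Retirement lemma.** For every coordinate `j` of a hard rectangle there is a value `v` such that restricting BOTH
players to `a_j = v`, `b_j = v` keeps all but two units of hardness. -/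
theorem retire_two {A B : Set (ι → Bool)} {ℓ : ℕ} (h : Hard A B ℓ) (j : ι) :
    ∃ v : Bool, Hard (A ∩ {a | a j = v}) (B ∩ {b | b j = v}) (ℓ - 2) := by
  classical
  by_cases hℓ : ℓ ≤ 2
  · refine ⟨false, ?_⟩
    have : ℓ - 2 = 0 := by omega
    rw [this]
    exact hard_zero _ _
  · have hB : B.Nonempty := h.nonempty_right (by omega) j
    obtain ⟨β, -, h1⟩ := Hard.split_bob h hB j (fun b => b j)
    have hA : A.Nonempty := h1.nonempty_left (by omega) j
    obtain ⟨β', -, h2⟩ := Hard.split_alice h1 hA j (fun a => a j)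
    by_cases hββ : β' = β
    · subst hββ
      refine ⟨β', ?_⟩
      have : ℓ - 2 = ℓ - 1 - 1 := by omega
      rw [this]
      exact h2
    · -- the mixed quadrant is solved by the leaf `j`, so it has hardness 0: contradiction with ℓ > 2
      exfalso
      have hsol : SolvesRect (KWTree.leaf j) (A ∩ {a | a j = β'}) (B ∩ {b | b j = β}) := by
        intro a ha b hb
        have ha' : a j = β' := ha.2
        have hb' : b j = β := hb.2
        simp only [KWTree.run_leaf, ne_eq, ha', hb']
        exact hββ
      have h0 := h2.eq_zero_of_leaf hsol
      omega

/-- The same with the roles displayed symmetrically (Bob's coordinate first is how the proof goes; the statement is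
symmetric).  Iterating `retire_two` over `k` coordinates costs `≤ 2k`; with Bob's `k` splits followed by ONE
multi-forced-half step (`P4g21X.multiForcedHalf_alice`) the cost improves to `k + 1 + ⌈log₂ k⌉` (memo §5, remark). -/
theorem retire_two' {A B : Set (ι → Bool)} {ℓ : ℕ} (h : Hard A B ℓ) (j : ι) (hℓ : 2 < ℓ) :
    ∃ v : Bool, (A ∩ {a | a j = v}).Nonempty ∧ (B ∩ {b | b j = v}).Nonempty ∧
      Hard (A ∩ {a | a j = v}) (B ∩ {b | b j = v}) (ℓ - 2) := by
  obtain ⟨v, hv⟩ := retire_two h j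
  exact ⟨v, hv.nonempty_left (by omega) j, hv.nonempty_right (by omega) j, hv⟩

end Retire

/-! ## §2 The 2-retired floor -/
section Floor

variable {ρ : Type u} [DecidableEq ρ]

/-- `RetiredFloorGe alive cr x` : the 2-retired floor of the credit family `cr` on the alive rows is `≥ x` — some set `S`
of alive rows, NOT all of them, can be retired (label-killed at cost `2` each, `retire_two`) so that every remaining
alive row has credit `≥ x + 2|S|`.  (`M* = max_S [min_{alive ∖ S} cr − 2|S|] = max_k [cr_(k+1) − 2k]`.) -/
def RetiredFloorGe (alive : Finset ρ) (cr : ρ → ℤ) (x : ℤ) : Prop :=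
  ∃ S : Finset ρ, S ⊆ alive ∧ S ≠ alive ∧ ∀ i ∈ alive \ S, x + 2 * (S.card : ℤ) ≤ cr i

omit [DecidableEq ρ] in
theorem RetiredFloorGe.mono [DecidableEq ρ] {alive : Finset ρ} {cr : ρ → ℤ} {x x' : ℤ} (hx : x' ≤ x)
    (h : RetiredFloorGe alive cr x) : RetiredFloorGe alive cr x' := by
  obtain ⟨S, hS, hne, hcr⟩ := h
  exact ⟨S, hS, hne, fun i hi => le_trans (by linarith) (hcr i hi)⟩

/-- An event that lowers every alive credit by at most one (an affine bit: each row load rises by `≤ 1`) lowers the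
retired floor by at most one. -/
theorem RetiredFloorGe.of_drop_le_one {alive : Finset ρ} {cr cr' : ρ → ℤ} {x : ℤ}
    (hdrop : ∀ i ∈ alive, cr i - 1 ≤ cr' i) (h : RetiredFloorGe alive cr x) :
    RetiredFloorGe alive cr' (x - 1) := by
  obtain ⟨S, hS, hne, hcr⟩ := h
  refine ⟨S, hS, hne, fun i hi => ?_⟩
  have hi' : i ∈ alive := (Finset.mem_sdiff.1 hi).1
  have := hcr i hi
  have := hdrop i hi'
  linarith

/-- The plain floor (`S = ∅`): if every alive credit is `≥ x` and some row may stay un-retired... i.e. `alive` is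
nonempty, then `M* ≥ x`. -/
theorem RetiredFloorGe.of_forall {alive : Finset ρ} {cr : ρ → ℤ} {x : ℤ} (hne : alive.Nonempty)
    (h : ∀ i ∈ alive, x ≤ cr i) : RetiredFloorGe alive cr x := by
  refine ⟨∅, Finset.empty_subset _, ?_, fun i hi => ?_⟩
  · intro h0; exact hne.ne_empty h0.symm
  · simp only [Finset.sdiff_empty] at hi
    simpa using h i hi

/-- Retiring ONE bottom row: if every alive row other than `i₀` has credit `≥ x + 2` and there is such a row, then
`M* ≥ x` even if `cr i₀` is arbitrarily low (the dump row of memo §3 is cashed for two label units). -/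
theorem RetiredFloorGe.of_retire_one {alive : Finset ρ} {cr : ρ → ℤ} {x : ℤ} {i₀ : ρ} (hi₀ : i₀ ∈ alive)
    (hother : ∃ i ∈ alive, i ≠ i₀) (h : ∀ i ∈ alive, i ≠ i₀ → x + 2 ≤ cr i) :
    RetiredFloorGe alive cr x := by
  refine ⟨{i₀}, by simpa using hi₀, ?_, fun i hi => ?_⟩
  · intro h0
    obtain ⟨i, hi, hne⟩ := hother
    rw [← h0] at hi
    exact hne (Finset.mem_singleton.1 hi)
  · have hi' := Finset.mem_sdiff.1 hi
    have hne : i ≠ i₀ := by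
      intro h0; apply hi'.2; simp [h0]
    simpa using h i hi'.1 hne

end Floor

end Summit.PneNP.PneNP.Cruxes.StrongComposition.P4g22X
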